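import Summits.CriticalPhenomena.PercolationContinuityZ3.Theorems.PercNearOneGluingNoHeavyLowerTailSahiStrongCubicMax
import Summits.CriticalPhenomena.PercolationContinuityZ3.Theorems.PercNearOneGluingNoHeavyLowerTailSahiStrongCubicMaxAtomCovering
import Summits.CriticalPhenomena.PercolationContinuityZ3.Theorems.PercNearOneGluingNoHeavyLowerTailSahiStrongCubicMaxSeparated
import Mathlib.Tactic.Linarith
import HarnessLib

/-!
# `NoHeavyLowerTail` (crux stmt-CriticalPhenomena-4575), master-family line P1 (gen 16):
# the MASS-TRANSFER (reduction) principle for the one-payer functional `strongCubicMax`, and the two stratum theorems in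
# `strongCubicMax` form

Support file (seat `prim-masterthm-p1`, gen 16; `--supports stmt-CriticalPhenomena-4575`).  Pure proof file, no `sorry`, standard axioms.
Memo `run/shared/lean/prim/prim-masterthm/FROM-prim-masterthm-p1-g16-ONE-PAYER.md` §7–§8.

* `strongCubicMax_mono_petals` — for two sandwiched triples with the SAME OUTSIDE mass, if the petals of the first are lighter and the first
  satisfies Gladkov's inequality `G ≥ 0` (e.g. up-sets), then `F^max(second) ≤ F^max(first)`: moving petal mass into the core never decreases
  the one-payer functional.  Hence (memo §8) the conjecture `StrongCubicMaxNonneg` reduces to K-REDUCED systems (core = what the petals force).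
* `strongCubicMax_mono_petals_core` — the same at fixed CORE mass (moving petal mass into the outside); reduction to O-reduced systems.
* `strongCubicMax_nonneg_of_atomCovering`, `strongCubicMax_nonneg_of_separated` — the stratum theorems of `…SahiStrongCubicMaxAtomCovering` /
  `…SahiStrongCubicMaxSeparated` restated for the tree's `strongCubicMax` (so they are literally instances of the body of `StrongCubicMaxNonneg`).
-/

noncomputable section

open scoped Classical

namespace Summit.CriticalPhenomena.PercolationContinuityZ3.Theorems

namespace SahiDeepCore

open Literature.Combinatorics.Sahi2008
open Literature.Probability.Percolation.DecisionTree (ind ind_of_mem ind_of_not_mem ind_nonneg)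

variable {ι : Type} [Fintype ι]

local notation3 (prettyPrint := false) "m⟦" p ", " X "⟧" => ex (bernoulliWeight p) (ind X)

/-- `0 ≤ μ_p(X)`. [folklore] -/
private theorem massTr_nonneg (p : ι → unitInterval) (X : Set (Set ι)) : 0 ≤ m⟦p, X⟧ :=
  ex_nonneg (isFKGMeasure_bernoulliWeight p).nonneg fun ω => ind_nonneg _ ω

/-- **TRANSFER PRINCIPLE for `strongCubicMax` at fixed outside mass.**  If `(A,B,N)` and `(A',B',N')` are sandwiched triples with the same
outside mass, the petals of the first are lighter than those of the second, and the first has `G ≥ 0`, then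
`strongCubicMax p A' B' N' ≤ strongCubicMax p A B N`. [this work] -/
theorem strongCubicMax_mono_petals (p : ι → unitInterval) {A B N A' B' N' : Set (Set ι)}
    (ho : m⟦p, (A' ∪ B')ᶜ⟧ = m⟦p, (A ∪ B)ᶜ⟧) (hα : m⟦p, A \ B⟧ ≤ m⟦p, A' \ B'⟧) (hβ : m⟦p, B \ A⟧ ≤ m⟦p, B' \ A'⟧)
    (hd : m⟦p, (A ∩ B) \ N⟧ ≤ m⟦p, (A' ∩ B') \ N'⟧) (hG : 0 ≤ gladkovDefect p A B N) :
    strongCubicMax p A' B' N' ≤ strongCubicMax p A B N := by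
  have hs := cells_sum_eq_one p A B N
  have hs' := cells_sum_eq_one p A' B' N'
  have hk : m⟦p, A ∩ B ∩ N⟧ = 1 - m⟦p, (A ∪ B)ᶜ⟧ - m⟦p, A \ B⟧ - m⟦p, B \ A⟧ - m⟦p, (A ∩ B) \ N⟧ := by linarith
  have hk' : m⟦p, A' ∩ B' ∩ N'⟧ = 1 - m⟦p, (A ∪ B)ᶜ⟧ - m⟦p, A' \ B'⟧ - m⟦p, B' \ A'⟧ - m⟦p, (A' ∩ B') \ N'⟧ := by
    linarith
  simp only [strongCubicMax, gladkovDefect] at hG ⊢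
  rw [hk] at hG ⊢
  rw [hk', ho]
  exact maxCells_antitone (massTr_nonneg p _) (massTr_nonneg p _) (massTr_nonneg p _) (massTr_nonneg p _) hα hβ hd hG

/-- **TRANSFER PRINCIPLE for `strongCubicMax` at fixed core mass** (petal mass moved into the outside). [this work] -/
theorem strongCubicMax_mono_petals_core (p : ι → unitInterval) {A B N A' B' N' : Set (Set ι)}
    (hk : m⟦p, A' ∩ B' ∩ N'⟧ = m⟦p, A ∩ B ∩ N⟧) (hα : m⟦p, A \ B⟧ ≤ m⟦p, A' \ B'⟧) (hβ : m⟦p, B \ A⟧ ≤ m⟦p, B' \ A'⟧)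
    (hd : m⟦p, (A ∩ B) \ N⟧ ≤ m⟦p, (A' ∩ B') \ N'⟧) (hG : 0 ≤ gladkovDefect p A B N) :
    strongCubicMax p A' B' N' ≤ strongCubicMax p A B N := by
  have hs := cells_sum_eq_one p A B N
  have hs' := cells_sum_eq_one p A' B' N'
  have ho : m⟦p, (A ∪ B)ᶜ⟧ = 1 - m⟦p, A ∩ B ∩ N⟧ - m⟦p, A \ B⟧ - m⟦p, B \ A⟧ - m⟦p, (A ∩ B) \ N⟧ := by linarith
  have ho' : m⟦p, (A' ∪ B')ᶜ⟧ = 1 - m⟦p, A ∩ B ∩ N⟧ - m⟦p, A' \ B'⟧ - m⟦p, B' \ A'⟧ - m⟦p, (A' ∩ B') \ N'⟧ := by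
    linarith
  simp only [strongCubicMax, gladkovDefect] at hG ⊢
  rw [ho] at hG ⊢
  rw [ho', hk]
  have hG' : 0 ≤ m⟦p, A ∩ B ∩ N⟧ * (1 - m⟦p, A ∩ B ∩ N⟧ - m⟦p, A \ B⟧ - m⟦p, B \ A⟧ - m⟦p, (A ∩ B) \ N⟧)
      - (m⟦p, A \ B⟧ * m⟦p, B \ A⟧ + m⟦p, A \ B⟧ * m⟦p, (A ∩ B) \ N⟧ + m⟦p, B \ A⟧ * m⟦p, (A ∩ B) \ N⟧) := by linarith
  have key := maxCells_antitone_core (massTr_nonneg p _) (massTr_nonneg p _) (massTr_nonneg p _) (massTr_nonneg p _) hα hβ hd hG'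
  have e1 : max (m⟦p, A ∩ B ∩ N⟧) (1 - m⟦p, A ∩ B ∩ N⟧ - m⟦p, A \ B⟧ - m⟦p, B \ A⟧ - m⟦p, (A ∩ B) \ N⟧) *
      (m⟦p, A ∩ B ∩ N⟧ * (1 - m⟦p, A ∩ B ∩ N⟧ - m⟦p, A \ B⟧ - m⟦p, B \ A⟧ - m⟦p, (A ∩ B) \ N⟧)
        - (m⟦p, A \ B⟧ * m⟦p, B \ A⟧ + m⟦p, A \ B⟧ * m⟦p, (A ∩ B) \ N⟧ + m⟦p, B \ A⟧ * m⟦p, (A ∩ B) \ N⟧))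
      = max (m⟦p, A ∩ B ∩ N⟧) (1 - m⟦p, A ∩ B ∩ N⟧ - m⟦p, A \ B⟧ - m⟦p, B \ A⟧ - m⟦p, (A ∩ B) \ N⟧) *
      (m⟦p, A ∩ B ∩ N⟧ * (1 - m⟦p, A ∩ B ∩ N⟧ - m⟦p, A \ B⟧ - m⟦p, B \ A⟧ - m⟦p, (A ∩ B) \ N⟧)
        - (m⟦p, A \ B⟧ * m⟦p, B \ A⟧ + m⟦p, A \ B⟧ * m⟦p, (A ∩ B) \ N⟧ + m⟦p, B \ A⟧ * m⟦p, (A ∩ B) \ N⟧)) := rfl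
  linarith

/-- **S₃^max on the atom-covering stratum, `strongCubicMax` form.** [this work] -/
theorem strongCubicMax_nonneg_of_atomCovering (p : ι → unitInterval) {G₁ G₂ G₃ : Set (Set ι)} (h₁ : IsUpperSet G₁)
    (h₂ : IsUpperSet G₂) (h₃ : IsUpperSet G₃) (hcov : ∀ u : ι, ({u} : Set ι) ∈ G₁ ∪ G₂ ∪ G₃)
    (h0 : (∅ : Set ι) ∉ G₁ ∪ G₂ ∪ G₃) :
    0 ≤ strongCubicMax p (G₂ ∪ G₃) (G₁ ∪ G₃) (G₁ ∪ G₂) := by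
  have h := coSunflower_maxSide_nonneg_of_atomCovering p h₁ h₂ h₃ hcov h0
  simp only [strongCubicMax, gladkovDefect]
  exact h

/-- **S₃^max on the separated stratum, `strongCubicMax` form.** [this work] -/
theorem strongCubicMax_nonneg_of_separated (p : ι → unitInterval) {G₁ G₂ G₃ : Set (Set ι)} (h₁ : IsUpperSet G₁)
    (h₂ : IsUpperSet G₂) (h₃ : IsUpperSet G₃) (hu₁ : Set.univ ∈ G₁) (hu₂ : Set.univ ∈ G₂)
    (hsep : ∀ u : ι, ¬(({u}ᶜ : Set ι) ∈ G₁ ∧ ({u}ᶜ : Set ι) ∈ G₂) ∧ ¬(({u}ᶜ : Set ι) ∈ G₁ ∧ ({u}ᶜ : Set ι) ∈ G₃) ∧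
      ¬(({u}ᶜ : Set ι) ∈ G₂ ∧ ({u}ᶜ : Set ι) ∈ G₃)) :
    0 ≤ strongCubicMax p (G₂ ∪ G₃) (G₁ ∪ G₃) (G₁ ∪ G₂) := by
  have h := coSunflower_maxSide_nonneg_of_separated p h₁ h₂ h₃ hu₁ hu₂ hsep
  simp only [strongCubicMax, gladkovDefect]
  exact h

end SahiDeepCore

end Summit.CriticalPhenomena.PercolationContinuityZ3.Theorems
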